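import Summits.HodgeConjecture.HodgeConjecture.Theorems.NikulinTwinTransportCruxesOfKugaSatakeOfB22
import Literature.AlgebraicGeometry.Surfaces.K3LatticeInvariantsChernProofs
import Literature.AlgebraicGeometry.Surfaces.K3SurfaceBuskinLeaves
import Literature.AlgebraicGeometry.Surfaces.K3SurfaceBuskinCupLeafHolds
import Literature.AlgebraicGeometry.HodgeTheory.BlochSemiregularSpread

/-!
# Route MarkmanPartnerTransport · crux `PicardThreeK3Squares` (stmt-HodgeConjecture-19652) —
# the three named-fact stubs of line `cm-anchor-spread`: exact residuals, in the kernel (CONDITIONAL closers)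

The registered skeleton of the crux (`ledger skeleton check`, sha `39ba70b5986d…`, line
`cm-anchor-spread` r2) has, after `stub_algebraicLocusClosed` was closed by name (p794133), five open
stubs. Three of them are NAMED PUBLISHED FACTS of the tree, taken verbatim as stub signatures:

* `stub_k3Marking : Huybrechts_K3_marking_exists` (Huybrechts, *Lectures on K3 Surfaces*, Ch. 1
  Prop. 3.5: every projective K3 surface admits a marking `H²(S(ℂ); ℤ) ≅ Λ_{K3}` with its period);
* `stub_buskinIsometry : Buskin2019_hodgeIsometry_algebraic` (Buskin 2019 Thm. 1.1: every rational
  Hodge isometry `T(S')_ℚ → T(S)_ℚ` of projective K3 surfaces is algebraic);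
* `stub_blochSpread : BlochSemiregularSpread 4 2` (Bloch 1972 Thm. (7.4) / Buchweitz–Flenner 2003
  Thm. 5.2, class form, relative dimension `4`, codimension `2`).

None is proved in the tree, and none is in reach of a proof here. This helper file records — as
kernel-checked CONDITIONAL theorems (D-0014: a named fact `X` taken as a hypothesis `(hX : X)`), not as
closers — the EXACT residual of each, by composing the reductions the tree already proves:

1. `stub_k3Marking_of_hirzebruch_of_oddBetti` — the marking fact follows from the TWO named facts
   `Literature.Geometry.Symplectic.hirzebruch_firstChernClass_sq_eq_almostComplex_four`
   (`⟨c₁², [N]⟩ = 2e + 3τ` on closed almost complex `4`-manifolds, McDuff–Salamon (4.1.7): the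
   `4`-dimensional signature theorem) and `Huybrechts_K3_oddBetti_vanish` (`b₁ = b₃ = 0`, whose own
   residual is Serre's GAGA comparison for `H¹(S, 𝒪_S)`, file `K3BettiNumbersOfGAGA`): through
   `b₂ = 22` (`K3_finrank_complexBetti_two_of_hirzebruch_of_oddBetti`) and the marking theorem from
   `b₂ = 22` (`NikulinTwinTransport.huybrechts_K3_marking_exists_of_b22`: evenness, index `−16`,
   Hodge–Riemann, Milnor's classification — all proved).
2. `stub_buskinIsometry_of_reflective_of_periodSurjective` — Buskin's theorem follows from the two
   named facts `Buskin2019_reflectiveHodgeIsometry_algebraic` (Buskin Prop. 6.2 for reflective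
   isometries: hyperholomorphic transport along twistor paths) and
   `Huybrechts_K3_periodSurjective_projective` (surjectivity of the period map, projective form),
   plus the two facts of item 1 (the cup-product leaf
   `cupProduct_mem_algebraicClasses_tripleProduct_surfaces` being PROVED,
   `cupProduct_mem_algebraicClasses_tripleProduct_surfaces_holds`): the tree's assembly
   `Buskin2019_hodgeIsometry_algebraic_holds_of` (Cartan–Dieudonné over `ℚ` + composition of
   correspondences).
3. `stub_blochSpread_of_interior` — `BlochSemiregularSpread 4 2` is the FIRST INTERIOR CELL
   (`4 ≤ n`, `2 ≤ p ≤ n − 2`) of Bloch's theorem, i.e. the first cell outside the Lefschetz range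
   `p ≤ 1 ∨ n ≤ p + 1` and the range `n ≤ 3` where the tree proves the fact outright
   (`PrymCanonicalZ3SplitSeeds.blochSpread_cells_holds`); no reduction of it is known to the tree, so
   the recorded residual is the interior family itself.

So the three stubs are closed MODULO exactly four named published facts — the signature theorem in
dimension `4`, GAGA for `H¹(S, 𝒪_S)` of a K3 surface (as `Huybrechts_K3_oddBetti_vanish`), Buskin's
Prop. 6.2, the surjectivity of the K3 period map — and Bloch's semiregularity theorem in the cell
`(4, 2)`. The other two open stubs of the skeleton are not touched: `stub_rmSpreadFamilyAnchored` (found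
false in substance by the line's lead, gen 2; record `Cruxes/PicardThreeK3Squares/Lines/cm-anchor-spread-dead.md`)
and the plan-only rung `stub_rung_rank13`.

Honesty box. Every theorem here is CONDITIONAL on the named facts it lists; nothing here closes a stub,
proves the crux `PicardThreeK3Squares`, or proves any instance of the Hodge conjecture. No definition,
no sorry, no new named fact. Prover seat leafhand-hodge-markmanpartnertran-1 (gen 1),
`--supports stmt-HodgeConjecture-19652`.

## References

* [Huybrechts2016K3] D. Huybrechts, Lectures on K3 Surfaces (CUP 2016), Ch. 1 §3.3 and Prop. 3.5;
  Ch. 6 Thm. 3.1, Rem. 3.3; Ch. 7 Thm. 4.1.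
* [Buskin2019] N. Buskin, Every rational Hodge isometry between two K3 surfaces is algebraic,
  J. reine angew. Math. 755 (2019), Thm. 1.1, Prop. 6.2.
* [McDuffSalamon2017] D. McDuff, D. Salamon, Introduction to Symplectic Topology, 3rd ed. (2017),
  Rem. 4.1.10 (4.1.7).
* [SerreGAGA1956] J.-P. Serre, Géométrie algébrique et géométrie analytique, Ann. Inst. Fourier 6
  (1956), §3 n°12 Thm. 1.
* [Bloch1972Semiregularity] S. Bloch, Semi-regularity and de Rham cohomology, Invent. Math. 17
  (1972), Thm. (7.4). [BuchweitzFlenner2003] R.-O. Buchweitz, H. Flenner, Compositio Math. 137 (2003),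
  Thm. 5.2.
-/

set_option linter.dupNamespace false

noncomputable section

namespace Summit.HodgeConjecture.HodgeConjecture.Theorems.MarkmanPartnerTransport.CmAnchorSpread

open Literature.AlgebraicGeometry.Surfaces Literature.AlgebraicGeometry.HodgeTheory
open Literature.Geometry.Symplectic

/-- **Residual of the registered stub `stub_k3Marking : Huybrechts_K3_marking_exists`** (line
`cm-anchor-spread`, crux `PicardThreeK3Squares`): the marking theorem for projective K3 surfaces
(Huybrechts Ch. 1 Prop. 3.5 with Ch. 6 Prop. 1.2) follows from the two named facts
`hirzebruch_firstChernClass_sq_eq_almostComplex_four` (the signature theorem in dimension `4`,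
almost complex form `⟨c₁², [N]⟩ = 2e + 3τ`) and `Huybrechts_K3_oddBetti_vanish` (`b₁ = b₃ = 0`):
they give `b₂ = 22` (`K3_finrank_complexBetti_two_of_hirzebruch_of_oddBetti`), from which the tree
PROVES the marking (`NikulinTwinTransport.huybrechts_K3_marking_exists_of_b22`). CONDITIONAL on the
two facts; not a closer. [cite: Huybrechts2016K3, Ch. 1 §3.3 p. 24 and Prop. 3.5]
[cite: McDuffSalamon2017, Rem. 4.1.10 (4.1.7)] -/
theorem stub_k3Marking_of_hirzebruch_of_oddBetti
    (hHW : hirzebruch_firstChernClass_sq_eq_almostComplex_four)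
    (hodd : Huybrechts_K3_oddBetti_vanish) :
    Huybrechts_K3_marking_exists :=
  NikulinTwinTransport.huybrechts_K3_marking_exists_of_b22
    (K3_finrank_complexBetti_two_of_hirzebruch_of_oddBetti hHW hodd)

/-- **Residual of the registered stub `stub_buskinIsometry : Buskin2019_hodgeIsometry_algebraic`**
(line `cm-anchor-spread`, crux `PicardThreeK3Squares`): Buskin's Thm. 1.1 (every rational Hodge
isometry of transcendental lattices of projective K3 surfaces is algebraic) follows from the named
facts `Buskin2019_reflectiveHodgeIsometry_algebraic` (Prop. 6.2 for reflective isometries),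
`Huybrechts_K3_periodSurjective_projective` (surjectivity of the period map, projective form), and the
two facts behind the marking (`stub_k3Marking_of_hirzebruch_of_oddBetti`), through the tree's PROVED
assembly `Buskin2019_hodgeIsometry_algebraic_holds_of` (Cartan–Dieudonné over `ℚ`, composition of
correspondences) with its cup-product leaf discharged
(`cupProduct_mem_algebraicClasses_tripleProduct_surfaces_holds`). CONDITIONAL on the four facts; not
a closer. [cite: Buskin2019, Thm. 1.1 and §6.2 Prop. 6.2]
[cite: Huybrechts2016K3, Ch. 6 Thm. 3.1, Rem. 3.3 and Ch. 7 Thm. 4.1] -/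
theorem stub_buskinIsometry_of_reflective_of_periodSurjective
    (hrefl : Buskin2019_reflectiveHodgeIsometry_algebraic)
    (hsurj : Huybrechts_K3_periodSurjective_projective)
    (hHW : hirzebruch_firstChernClass_sq_eq_almostComplex_four)
    (hodd : Huybrechts_K3_oddBetti_vanish) :
    Buskin2019_hodgeIsometry_algebraic :=
  Buskin2019_hodgeIsometry_algebraic_holds_of hrefl
    cupProduct_mem_algebraicClasses_tripleProduct_surfaces_holds hsurj
    (stub_k3Marking_of_hirzebruch_of_oddBetti hHW hodd)

/-- **Residual of the registered stub `stub_blochSpread : BlochSemiregularSpread 4 2`** (line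
`cm-anchor-spread`, crux `PicardThreeK3Squares`): the cell `(n, p) = (4, 2)` — a semiregular local
complete intersection surface in a fourfold fibre spreading the algebraicity of a flat `(2,2)`-class to
nearby fibres — is the first INTERIOR cell `4 ≤ n`, `2 ≤ p`, `p + 2 ≤ n` of Bloch's theorem, outside
the ranges where the tree proves the fact outright (`p ≤ 1 ∨ n ≤ 3 ∨ n ≤ p + 1`,
`PrymCanonicalZ3SplitSeeds.blochSpread_cells_holds`); the residual is Bloch's theorem proper, recorded
here as the interior family. CONDITIONAL; not a closer.
[cite: Bloch1972Semiregularity, Thm. (7.4) and Remark (7.5)] [cite: BuchweitzFlenner2003, Thm. 5.2] -/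
theorem stub_blochSpread_of_interior
    (h : ∀ n p : ℕ, 4 ≤ n → 2 ≤ p → p + 2 ≤ n → BlochSemiregularSpread n p) :
    BlochSemiregularSpread 4 2 :=
  h 4 2 le_rfl le_rfl le_rfl

end Summit.HodgeConjecture.HodgeConjecture.Theorems.MarkmanPartnerTransport.CmAnchorSpread

end
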